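import Literature.MathematicalPhysics.QuantumFieldTheory.Balaban1983to89.B5G183RateWgtPieces
import Literature.MathematicalPhysics.QuantumFieldTheory.Balaban1983to89.B5G183RateWThetaDiag
import Literature.MathematicalPhysics.QuantumFieldTheory.Balaban1983to89.B5G183RateWThetaSharp

/-!
# Bałaban [CMP 95 (1984)] Prop. 1.1 (1.89) at `U = 1`, order two: the `W^θ∂ ⊗ W^θ∂` eta-rate HOLDS with
exponent `min(2θ, 1)` — `OrderTwoOpRateResidualWθ d a (CW1op d a) θ (min (2θ) 1)`

HONEST FRAMING (cell `pub-balaban`, T⁴ programme, estimate NE2 = U1a «η-rate, linear theory»).  Finite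
torus, `η = 1/n`, trivial background `U = 1`, one nonzero reduced momentum `p′` at a time, `ℓ²`-operator
norm on the alias classes `× Fin d`.  Nothing here is about infinite volume, `U ≠ 1`, a mass gap, or
any summit statement.  Bałaban prints NO rate; the currency (`B5G183RateWTheta.OrderTwoOpRateResidualWθ`),
King's pairing, the weights and every constant are OURS ([folklore]).

WHAT IS PRINTED.  [Balaban1984PropagatorsI] p. 33: «Proposition 1.1. The operator G is a symmetric
operator on L²(T_η) and ‖GJ‖, ‖∇GJ‖, ‖G∇*J‖, ‖∇G∇*J‖, ‖∇∇GJ‖, ‖G∇*∇*J‖ ≤ γ₀⁻¹‖J‖, (1.89) with a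
positive constant γ₀ independent of k, T_η, and depending on d only (if we put a = 1).»  [King1986]
p. 672 (4.20) `|u(p′+l)| ≤ Π_μ |p′_μ||p′_μ + l_μ|⁻¹`,
(4.22) «≤ C for α < 1.», (4.23) «≤ CL^{−γk} for α + γ < 1»; p. 673 «So keeping γ + α < 1, the error
produced by the above replacement is bounded by CL^{−γk}.»  (renders ref1 p017, king p024/p025, read as
images by this lineage.)

WHAT THIS MODULE PROVES (kernel, [folklore]; a two-line assembly of `B5G183RateWgtPieces.residualWθ_le_diag_add`
— the four finite-rank pieces at rate `CfrW/N` for every `θ ≥ 0` — and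
`B5G183RateWThetaDiag.opNorm_dg_piece_Wθ_le` — the free diagonal at rate `CdgW1/N^{min(2θ,1)}`):
  **`orderTwoOpRateResidualWθ_holds d a hθ0 hθ1 : OrderTwoOpRateResidualWθ d a (CW1op d a) θ (min (2 * θ) 1)`**
for `0 ≤ θ ≤ 1`, with the SAME constant `CW1op` as the `θ = 1` endpoint
(`B5G183RateWTheta.orderTwoOpRateResidualWθ_one_holds`); corollaries: exponent `2θ` for `θ ≤ 1/2`,
exponent `1` for `θ ≥ 1/2`, every `γ ≤ min(2θ,1)` (`a > 0`).  In King's language: weights of total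
momentum power `α = 2θ` on the order-two item buy the rate `γ = min(α, 1)` in our operator currency.
§2 joins this with the negative leaf `B5G183RateWThetaSharp` (`γ > 2θ` impossible for `θ < 1`, `d ≥ 1`):
**`orderTwoOpRateWθ_iff`** — for `0 ≤ θ ≤ 1/2`, `(∃ C, OrderTwoOpRateResidualWθ d a C θ γ) ↔ γ ≤ 2θ`
(the exponent `2θ` is SHARP) — and `exponent_summary` (`0 ≤ θ < 1`: every `γ ≤ min(2θ,1)` attained,
every `γ > 2θ` refuted).

NOT CLAIMED: the gap `(1, 2θ]` for `1/2 < θ < 1` and `γ > 1` at `θ = 1` (a lower bound on the finite-rank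
pieces would be needed), `p′`-derivatives, `∫dp′`, Prop. 1.2 decay with a rate, `U ≠ 1`, constants.
-/

noncomputable section

namespace Literature.MathematicalPhysics.QuantumFieldTheory.Balaban1983to89.B5G183RateWThetaHolds

open scoped BigOperators ComplexConjugate Matrix.Norms.L2Operator
open Finset Complex
open Literature.MathematicalPhysics.QuantumFieldTheory.Balaban1983to89.B4Strip
open Literature.MathematicalPhysics.QuantumFieldTheory.Balaban1983to89.B5Prop11Fiber
open Literature.MathematicalPhysics.QuantumFieldTheory.Balaban1983to89.B5Prop11Bound
open Literature.MathematicalPhysics.QuantumFieldTheory.Balaban1983to89.B5Hk163Rate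
open Literature.MathematicalPhysics.QuantumFieldTheory.Balaban1983to89.B5G183RateOp
open Literature.MathematicalPhysics.QuantumFieldTheory.Balaban1983to89.B5G183RateO2Op
open Literature.MathematicalPhysics.QuantumFieldTheory.Balaban1983to89.B5G183RatePieces
open Literature.MathematicalPhysics.QuantumFieldTheory.Balaban1983to89.B5G183RateW1Diag
open Literature.MathematicalPhysics.QuantumFieldTheory.Balaban1983to89.B5G183RateW1RankOne
open Literature.MathematicalPhysics.QuantumFieldTheory.Balaban1983to89.B5G183RateWTheta
open Literature.MathematicalPhysics.QuantumFieldTheory.Balaban1983to89.B5G183RateWgtPieces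
open Literature.MathematicalPhysics.QuantumFieldTheory.Balaban1983to89.B5G183RateWThetaDiag
open Literature.MathematicalPhysics.QuantumFieldTheory.Balaban1983to89.B5G183RateWThetaSharp
open Literature.MathematicalPhysics.QuantumFieldTheory.King1986

variable {d : ℕ}

section Main

variable {N R : ℕ} [NeZero N] [NeZero R]

/-- `CW1op ≥ 0` (`a > 0`). [folklore] -/
theorem CW1op_nonneg (d : ℕ) {a : ℝ} (ha : 0 < a) : 0 ≤ CW1op d a := by
  rw [CW1op_eq]; exact add_nonneg (CdgW1_nonneg d ha) (CfrW_nonneg d ha)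

/-- **THE PLANTED ORDER-TWO `W^θ∂_ν ⊗ W^θ∂_{ν′}` DIFFERENCE IS `O(N^{−min(2θ,1)})` IN OPERATOR NORM:**
for `N, R ≥ 1`, `a > 0`, `θ ∈ [0, 1]`, a nonzero reduced momentum `p′ = s` and directions `ν, ν′`,
`‖sandwich_{W^θ∂ν,W^θ∂ν′}(G^{(RN)}) − plant_R(sandwich(G^{(N)}))‖ ≤ CW1op(d,a)/N^{min(2θ,1)}` — the four
finite-rank pieces at `CfrW/N ≤ CfrW/N^{min(2θ,1)}` (`B5G183RateWgtPieces.residualWθ_le_diag_add`) plus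
the free diagonal at `CdgW1/N^{min(2θ,1)}` (`B5G183RateWThetaDiag.opNorm_dg_piece_Wθ_le`),
`CW1op = CdgW1 + CfrW`. [cite: Balaban1984PropagatorsI, (1.83) p.31, Prop. 1.1 (1.89) p.33; King1986,
(4.19)–(4.20), (4.23) p.672, (4.24) p.673] [folklore] -/
theorem residualWθ_le (hN : 1 ≤ N) (hR : 1 ≤ R) (hRN : 1 ≤ R * N) (a : ℝ) (ha : 0 < a) {θ : ℝ}
    (hθ0 : 0 ≤ θ) (hθ1 : θ ≤ 1) {s : Fin d → ℝ} (hs : ∀ ν, |s ν| ≤ Real.pi) (hs0 : s ≠ 0)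
    (ν ν' : Fin d) :
    ‖sandwich (fun K => wθdSym (R * N) θ K s ν) (fun K => wθdSym (R * N) θ K s ν')
          (balabanFiber (R * N) hRN a ha s hs hs0).G
        - plant R s (sandwich (fun k => wθdSym N θ k s ν) (fun k => wθdSym N θ k s ν')
          (balabanFiber N hN a ha s hs hs0).G)‖
      ≤ CW1op d a / (N : ℝ) ^ min (2 * θ) 1 := by
  have h1 := residualWθ_le_diag_add hN hR hRN a ha hθ0 hs hs0 ν ν'
  dsimp only at h1
  have h2 := opNorm_dg_piece_Wθ_le hN hR hRN a ha hs hs0 hθ0 hθ1 ν ν'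
  have hN0 : (0 : ℝ) < N := by exact_mod_cast hN
  have hN1 : (1 : ℝ) ≤ N := by exact_mod_cast hN
  have hNm : 0 < (N : ℝ) ^ min (2 * θ) 1 := Real.rpow_pos_of_pos hN0 _
  have hNm1 : (N : ℝ) ^ min (2 * θ) 1 ≤ N :=
    calc (N : ℝ) ^ min (2 * θ) 1 ≤ (N : ℝ) ^ (1 : ℝ) :=
          Real.rpow_le_rpow_of_exponent_le hN1 (min_le_right _ _)
      _ = N := Real.rpow_one _
  have h3 : CfrW d a / N ≤ CfrW d a / (N : ℝ) ^ min (2 * θ) 1 :=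
    div_le_div_of_nonneg_left (CfrW_nonneg d ha) hNm hNm1
  refine h1.trans ((add_le_add h2 h3).trans (le_of_eq ?_))
  rw [CW1op_eq, add_div]

/-- **ORDER TWO, `U = 1`, WEIGHTS `W^θ∂ ⊗ W^θ∂`, `0 ≤ θ ≤ 1`: THE eta-RATE HOLDS WITH EXPONENT
`min(2θ, 1)`** — `OrderTwoOpRateResidualWθ d a (CW1op d a) θ (min (2θ) 1)`, for every `d` and every
`a` (the currency quantifies `0 < a` internally).  Endpoint `θ = 1`:
`B5G183RateWTheta.orderTwoOpRateResidualWθ_one_holds`; endpoint `θ = 0`: exponent `0`, i.e. a uniform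
bound only, in line with `B5G183RateWTheta.not_orderTwoOpRateResidualWθ_zero`. [cite:
Balaban1984PropagatorsI, Prop. 1.1 (1.89) p.33; King1986, (4.20), (4.22)–(4.23) p.672, p.673] [folklore] -/
theorem orderTwoOpRateResidualWθ_holds (d : ℕ) (a : ℝ) {θ : ℝ} (hθ0 : 0 ≤ θ) (hθ1 : θ ≤ 1) :
    OrderTwoOpRateResidualWθ d a (CW1op d a) θ (min (2 * θ) 1) := by
  intro N R _ _ hN hRN ha s hs hs0 ν ν' hR
  exact residualWθ_le hN hR hRN a ha hθ0 hθ1 hs hs0 ν ν'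

/-- `θ ≤ 1/2`: exponent `2θ`. [folklore] -/
theorem orderTwoOpRateResidualWθ_two_mul (d : ℕ) (a : ℝ) {θ : ℝ} (hθ0 : 0 ≤ θ) (hθ : θ ≤ 1 / 2) :
    OrderTwoOpRateResidualWθ d a (CW1op d a) θ (2 * θ) := by
  have h := orderTwoOpRateResidualWθ_holds d a hθ0 (by linarith)
  rwa [min_eq_left (by linarith)] at h

/-- `1/2 ≤ θ ≤ 1`: exponent `1` (the rate of the finite-rank pieces; same exponent as `θ = 1`). [folklore] -/
theorem orderTwoOpRateResidualWθ_one_of_half_le (d : ℕ) (a : ℝ) {θ : ℝ} (hθ : 1 / 2 ≤ θ)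
    (hθ1 : θ ≤ 1) : OrderTwoOpRateResidualWθ d a (CW1op d a) θ 1 := by
  have h := orderTwoOpRateResidualWθ_holds d a (by linarith) hθ1
  rwa [min_eq_right (by linarith)] at h

/-- every smaller exponent `γ ≤ min(2θ,1)` (`a > 0`, so that `CW1op ≥ 0`). [folklore] -/
theorem orderTwoOpRateResidualWθ_of_le (d : ℕ) {a : ℝ} (ha : 0 < a) {θ γ : ℝ} (hθ0 : 0 ≤ θ)
    (hθ1 : θ ≤ 1) (hγ : γ ≤ min (2 * θ) 1) : OrderTwoOpRateResidualWθ d a (CW1op d a) θ γ :=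
  orderTwoOpRateResidualWθ_mono (CW1op_nonneg d ha) hγ (orderTwoOpRateResidualWθ_holds d a hθ0 hθ1)

/-- hence a constant exists for every `γ ≤ min(2θ,1)`: `∃ C, OrderTwoOpRateResidualWθ d a C θ γ`.
[folklore] -/
theorem exists_orderTwoOpRateWθ (d : ℕ) {a : ℝ} (ha : 0 < a) {θ γ : ℝ} (hθ0 : 0 ≤ θ) (hθ1 : θ ≤ 1)
    (hγ : γ ≤ min (2 * θ) 1) : ∃ C, OrderTwoOpRateResidualWθ d a C θ γ :=
  ⟨CW1op d a, orderTwoOpRateResidualWθ_of_le d ha hθ0 hθ1 hγ⟩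

end Main

/-! ## §2 The exponent decided (with `B5G183RateWThetaSharp`) [folklore] -/

section Decided

/-- **`0 ≤ θ ≤ 1/2`: THE EXPONENT `2θ` IS SHARP** — `(∃ C, OrderTwoOpRateResidualWθ d a C θ γ) ↔ γ ≤ 2θ`
(`d ≥ 1` via a direction `μ₁`, `a > 0`): `⇐` by `exists_orderTwoOpRateWθ`, `⇒` by
`B5G183RateWThetaSharp.no_orderTwoOpRateWθ_of_lt` (the unpaired on-axis witness). [cite:
Balaban1984PropagatorsI, Prop. 1.1 (1.89) p.33; King1986, (4.20), (4.23) p.672, p.673] [folklore] -/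
theorem orderTwoOpRateWθ_iff (μ₁ : Fin d) {a : ℝ} (ha : 0 < a) {θ γ : ℝ} (hθ0 : 0 ≤ θ)
    (hθ : θ ≤ 1 / 2) : (∃ C, OrderTwoOpRateResidualWθ d a C θ γ) ↔ γ ≤ 2 * θ := by
  constructor
  · intro h
    by_contra hγ
    exact no_orderTwoOpRateWθ_of_lt μ₁ a ha hθ0 (by linarith) (lt_of_not_ge hγ) h
  · intro hγ
    exact exists_orderTwoOpRateWθ d ha hθ0 (by linarith) (by rw [min_eq_left (by linarith)]; exact hγ)

/-- **`0 ≤ θ < 1`: SUMMARY** — every exponent `γ ≤ min(2θ, 1)` is attained (constant `CW1op d a`) and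
every exponent `γ > 2θ` is refuted for every constant; for `1/2 < θ < 1` the range `1 < γ ≤ 2θ` is not
decided here. [cite: Balaban1984PropagatorsI, Prop. 1.1 (1.89) p.33; King1986, (4.20), (4.22)–(4.23)
p.672, p.673] [folklore] -/
theorem exponent_summary (μ₁ : Fin d) {a : ℝ} (ha : 0 < a) {θ : ℝ} (hθ0 : 0 ≤ θ) (hθ1 : θ < 1) :
    (∀ γ, γ ≤ min (2 * θ) 1 → OrderTwoOpRateResidualWθ d a (CW1op d a) θ γ)
      ∧ (∀ γ, 2 * θ < γ → ∀ C, ¬ OrderTwoOpRateResidualWθ d a C θ γ) :=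
  ⟨fun _ hγ => orderTwoOpRateResidualWθ_of_le d ha hθ0 hθ1.le hγ,
    fun _ hγ _ => not_orderTwoOpRateResidualWθ_of_lt μ₁ a ha hθ0 hθ1 hγ⟩

end Decided

end Literature.MathematicalPhysics.QuantumFieldTheory.Balaban1983to89.B5G183RateWThetaHolds
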